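import Summits.QuantumFields.GaugeBoot.TiltedBoxOddAxisSlab
import Summits.QuantumFields.GaugeBoot.DiagonalRPTorusNontrivialRep
import HarnessLib

/-!
# The witness against axis reflection positivity on the odd square tilted box (gauge-boot, L3 negative supplement; twisted-slab mechanism, the test function)

HONEST FRAMING (cell `pub-gaugeboot`, page 1 of every file): the venture produces certified bounds
on lattice expectations at stated coupling, gauge group, dimension and torus size; NOT a mass gap,
NOT a continuum limit, NOT a string tension; NOT Yang–Mills-summit-bearing (barriers
`FixedCouplingUltralocality`, `PerturbativeInvisibility`). This is the test function of the
NEGATIVE result `TiltedBoxOddAxisRPNegative.lean`.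

On the square tilted box of odd side `M = 2P + 1` with the flip `Θ_i` along `i`
(`TiltedBoxOddAxisGeometry.lean`) the half observable refuting reflection positivity is

  `F(U) = (W_p(U) - W_{p+T}(U)) · exp(β ∑_q c_q (N - Re tr ρ(U_q)))`,

`p = (y₀; a, b)` a transverse plaquette of the layer `x_i ≡ P` (`y₀ = [P e_i]`, `a, b ≠ i`),
`T = [M e_j]` the twist, `c_q` the half-space weights (`halfWeight`). This file proves:

* `oddLayerSite`, `oddW`, `oddDiff = W_p - W_{p+T}`, `oddExpo = ∑_q c_q (N - Re tr ρ(U_q))`, `oddF`;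
  continuity/measurability/boundedness; **`isHalfObservable_oddF`** (every plaquette of non-zero
  weight and the two transverse plaquettes have all links in the closed half `{x_i ≤ P}`);
* **`oddExpo_configReflect_add`** — the cancellation of the Boltzmann weight:
  `E(ΘU) + E(U) - S(U) = -∑_{q slab} (N - Re tr ρ(U_q))` (`halfWeight_add_halfWeight_plaqReflect`
  summed over the involution `plaqReflect`);
* **`oddDiff_configReflect`** — `(W_p - W_{p+T})(ΘU) = W_{p↑+T}(U) - W_{p↑}(U)` with
  `p↑ = p + e_i` the plaquette ABOVE `p` (the twist lemma: `Θ_i y₀ = y₀ + T + e_i`, `Θ_i(y₀ + T) = y₀ + e_i`);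
* **`integral_oddDiff_sq_pos`** — `0 < ∫ (W_p - W_{p+T})² dμ₀` (product Haar; the two plaquettes are
  distinct: `T ≠ 0`, `T + e_b ≠ 0`, and `ρ` is non-trivial).

Everything is `[folklore]` bookkeeping.

References: J. Fröhlich, R. Israel, E. H. Lieb, B. Simon, J. Stat. Phys. 22 (1980) 297, §3;
K. Osterwalder, E. Seiler, Ann. Phys. 110 (1978) 440, §2.
-/

noncomputable section

open MeasureTheory QuotientAddGroup
open Literature.MathematicalPhysics.QuantumFieldTheory (haarProbability)
open Literature.RepresentationTheory.CompactGroups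

namespace Summit.QuantumFields.GaugeBoot

namespace TiltedRP

section Witness

variable {d : ℕ} {i j : Fin d} {L P N : ℕ} [NeZero L] [NeZero P]
variable {G : Type*} [Group G]

/-! ## The layer site, the twist facts -/

variable (d i j L P) in
/-- The reference site `y₀ = [P e_i]` of the layer `x_i ≡ P`. [folklore] -/
def oddLayerSite : TiltedSite d i j (2 * P + 1) (2 * P + 1) L :=
  ((Pi.single i (P : ℤ) : Fin d → ℤ) : TiltedSite d i j (2 * P + 1) (2 * P + 1) L)

omit [NeZero L] [NeZero P] in
/-- `x_i(y₀) = P`. [folklore] -/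
theorem axisCoord_oddLayerSite :
    axisCoord d L (2 * P + 1) (oddLayerSite d i j L P) = ((P : ℕ) : ZMod (2 * P + 1)) := by
  rw [oddLayerSite, axisCoord_mk, Pi.single_eq_same, Int.cast_natCast]

omit [NeZero L] [NeZero P] in
/-- `x_i(y₀ + T) = P`. [folklore] -/
theorem axisCoord_oddLayerSite_add_twist (hij : i ≠ j) :
    axisCoord d L (2 * P + 1) (oddLayerSite d i j L P + tiltedTwist d L (2 * P + 1)) =
      ((P : ℕ) : ZMod (2 * P + 1)) := by
  rw [map_add, axisCoord_oddLayerSite, axisCoord_tiltedTwist d L _ hij, add_zero]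

omit [NeZero L] in
/-- **`T + e_b ≠ 0` for `b ≠ i`** (and `T ≠ 0`: take the coefficient into account): the class of
`M e_j + e_b` has `x_i + x_j ∈ {M, M + 1}`, not divisible by `2M` for `M ≥ 3`. [folklore] -/
theorem tiltedTwist_add_unit_ne_zero (hij : i ≠ j) {b : Fin d} (hb : b ≠ i) :
    tiltedTwist d L (2 * P + 1) + tiltedUnit d i j (2 * P + 1) (2 * P + 1) L b ≠
      (0 : TiltedSite d i j (2 * P + 1) (2 * P + 1) L) := by
  have hP : P ≠ 0 := NeZero.ne P
  intro h
  rw [tiltedTwist, tiltedUnit, ← QuotientAddGroup.mk_add, QuotientAddGroup.eq_zero_iff,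
    mem_tiltedLattice_iff] at h
  obtain ⟨h1, -, -⟩ := h
  simp only [Pi.add_apply, Pi.single_eq_of_ne hij, Pi.single_eq_of_ne (Ne.symm hb), Pi.single_eq_same,
    zero_add] at h1
  by_cases hbj : b = j
  · subst hbj
    rw [Pi.single_eq_same] at h1
    have h2 := Int.le_of_dvd (by push_cast; positivity) h1
    push_cast at h2; omega
  · rw [Pi.single_eq_of_ne (Ne.symm hbj), add_zero] at h1
    have h3 := Int.le_of_dvd (by push_cast; positivity) h1
    push_cast at h3; omega

omit [NeZero L] [NeZero P] in
/-- **`T ≠ 0`.** [folklore] -/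
theorem tiltedTwist_ne_zero (hij : i ≠ j) :
    tiltedTwist d L (2 * P + 1) ≠ (0 : TiltedSite d i j (2 * P + 1) (2 * P + 1) L) := by
  intro h
  rw [tiltedTwist, QuotientAddGroup.eq_zero_iff, mem_tiltedLattice_iff] at h
  obtain ⟨h1, -, -⟩ := h
  simp only [Pi.single_eq_of_ne hij, Pi.single_eq_same, zero_add] at h1
  have h2 := Int.le_of_dvd (by push_cast; positivity) h1
  push_cast at h2; omega

/-! ## The observables -/

variable (ρ : G →* Matrix (Fin N) (Fin N) ℂ) (q : DirPair d)

/-- The observable `W_x = Re tr ρ(U_{(x; q)})` of the transverse plaquette `q` based at `x`. [folklore] -/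
def oddW (x : TiltedSite d i j (2 * P + 1) (2 * P + 1) L)
    (U : Config (TiltedSite d i j (2 * P + 1) (2 * P + 1) L) d G) : ℝ :=
  plaqObs ρ (tiltedUnit d i j (2 * P + 1) (2 * P + 1) L) (x, q) U

/-- The difference `W_{y₀} - W_{y₀ + T}`. [folklore] -/
def oddDiff (U : Config (TiltedSite d i j (2 * P + 1) (2 * P + 1) L) d G) : ℝ :=
  oddW ρ q (oddLayerSite d i j L P) U - oddW ρ q (oddLayerSite d i j L P + tiltedTwist d L (2 * P + 1)) U

/-- The half-weighted action `E(U) = ∑_q c_q (N - Re tr ρ(U_q))`. [folklore] -/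
def oddExpo (U : Config (TiltedSite d i j (2 * P + 1) (2 * P + 1) L) d G) : ℝ :=
  ∑ p : Plaq (TiltedSite d i j (2 * P + 1) (2 * P + 1) L) d,
    halfWeight p * ((N : ℝ) - plaqObs ρ (tiltedUnit d i j (2 * P + 1) (2 * P + 1) L) p U)

/-- **The witness** `F = (W_{y₀} - W_{y₀+T}) · exp(β E)`. [folklore] -/
def oddF (β : ℝ) (U : Config (TiltedSite d i j (2 * P + 1) (2 * P + 1) L) d G) : ℂ :=
  ((oddDiff ρ q U : ℝ) : ℂ) * ((Real.exp (β * oddExpo ρ U) : ℝ) : ℂ)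

section Regularity

variable [TopologicalSpace G] [IsTopologicalGroup G]

omit [NeZero L] [NeZero P] in
/-- `W_x` is continuous. [folklore] -/
theorem continuous_oddW (hρ : Continuous ρ) (x : TiltedSite d i j (2 * P + 1) (2 * P + 1) L) :
    Continuous fun U : Config (TiltedSite d i j (2 * P + 1) (2 * P + 1) L) d G => oddW ρ q x U :=
  continuous_plaqObs ρ hρ _ _

omit [NeZero L] [NeZero P] in
/-- `oddDiff` is continuous. [folklore] -/
theorem continuous_oddDiff (hρ : Continuous ρ) : Continuous fun U : Config (TiltedSite d i j (2 * P + 1) (2 * P + 1) L) d G => oddDiff ρ q U :=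
  (continuous_oddW ρ q hρ _).sub (continuous_oddW ρ q hρ _)

omit [NeZero P] in
/-- `E` is continuous. [folklore] -/
theorem continuous_oddExpo (hρ : Continuous ρ) : Continuous fun U : Config (TiltedSite d i j (2 * P + 1) (2 * P + 1) L) d G => oddExpo ρ U :=
  continuous_finsetSum _ fun p _ => continuous_const.mul (continuous_const.sub (continuous_plaqObs ρ hρ _ p))

omit [NeZero P] in
/-- `F` is continuous. [folklore] -/
theorem continuous_oddF (hρ : Continuous ρ) (β : ℝ) : Continuous fun U : Config (TiltedSite d i j (2 * P + 1) (2 * P + 1) L) d G => oddF ρ q β U :=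
  (Complex.continuous_ofReal.comp (continuous_oddDiff ρ q hρ)).mul
    (Complex.continuous_ofReal.comp (Real.continuous_exp.comp (continuous_const.mul (continuous_oddExpo ρ hρ))))

omit [NeZero P] in
/-- `F` is bounded (continuous on the compact configuration space). [folklore] -/
theorem exists_norm_oddF_le [CompactSpace G] (hρ : Continuous ρ) (β : ℝ) :
    ∃ C : ℝ, ∀ U : Config (TiltedSite d i j (2 * P + 1) (2 * P + 1) L) d G, ‖oddF ρ q β U‖ ≤ C := by
  obtain ⟨C, hC⟩ := isBounded_iff_forall_norm_le.1
    (isCompact_range (continuous_oddF (i := i) (j := j) (L := L) (P := P) ρ q hρ β)).isBounded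
  exact ⟨C, fun U => hC _ ⟨U, rfl⟩⟩

end Regularity

/-! ## The witness is a half observable -/

omit [NeZero L] in
/-- A transverse plaquette of a layer in the closed half has weight `cT`, hence all links in the
closed half. [folklore] -/
theorem halfWeight_transverse (x : TiltedSite d i j (2 * P + 1) (2 * P + 1) L) (hq1 : q.1.1 ≠ i) (hq2 : q.1.2 ≠ i)
    (hx : axisCoord d L (2 * P + 1) x = ((P : ℕ) : ZMod (2 * P + 1))) :
    halfWeight ((x, q) : Plaq (TiltedSite d i j (2 * P + 1) (2 * P + 1) L) d) = 1 := by
  have hP : P ≠ 0 := NeZero.ne P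
  have hPval : (((P : ℕ) : ZMod (2 * P + 1))).val = P := by
    rw [ZMod.val_natCast]; exact Nat.mod_eq_of_lt (by omega)
  have hP0 : ((P : ℕ) : ZMod (2 * P + 1)) ≠ 0 := fun h => by
    have := congrArg ZMod.val h; rw [hPval, ZMod.val_zero] at this; exact hP this
  unfold halfWeight cT
  simp only [hq1, hq2, or_self, if_false, hx, hP0, hPval, le_refl, if_true]

omit [NeZero L] [NeZero P] in
/-- Plaquette observables agree on configurations agreeing on the half links, for plaquettes of
non-zero weight. [folklore] -/
theorem plaqObs_eq_of_halfWeight_ne_zero {U V : Config (TiltedSite d i j (2 * P + 1) (2 * P + 1) L) d G}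
    (hUV : ∀ l, IsHalfLink (tiltedUnit d i j (2 * P + 1) (2 * P + 1) L) (2 * P + 1)
      (axisHeight2 d L (2 * P + 1)) l → U l = V l)
    {p : Plaq (TiltedSite d i j (2 * P + 1) (2 * P + 1) L) d} (hp : halfWeight p ≠ 0) :
    plaqObs ρ (tiltedUnit d i j (2 * P + 1) (2 * P + 1) L) p U =
      plaqObs ρ (tiltedUnit d i j (2 * P + 1) (2 * P + 1) L) p V := by
  obtain ⟨h1, h2, h3, h4⟩ := isHalfLink_of_halfWeight_ne_zero hp
  unfold plaqObs
  rw [holonomy_congr _ p.1 p.2.1.1 p.2.1.2 (hUV _ h1) (hUV _ h2) (hUV _ h3) (hUV _ h4)]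

/-- **The witness is an observable of the closed half `{0 ≤ x_i ≤ P}`.** [folklore] -/
theorem isHalfObservable_oddF (hij : i ≠ j) (hq1 : q.1.1 ≠ i) (hq2 : q.1.2 ≠ i) (β : ℝ) :
    IsHalfObservable (tiltedUnit d i j (2 * P + 1) (2 * P + 1) L) (2 * P + 1) (axisHeight2 d L (2 * P + 1))
      (fun U => oddF ρ q β U) := by
  intro U V hUV
  have hW : ∀ x, axisCoord d L (2 * P + 1) x = ((P : ℕ) : ZMod (2 * P + 1)) → oddW ρ q x U = oddW ρ q x V := by
    intro x hx
    exact plaqObs_eq_of_halfWeight_ne_zero ρ hUV (by rw [halfWeight_transverse q x hq1 hq2 hx]; norm_num)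
  have hD : oddDiff ρ q U = oddDiff ρ q V := by
    unfold oddDiff
    rw [hW _ axisCoord_oddLayerSite, hW _ (axisCoord_oddLayerSite_add_twist hij)]
  have hE : oddExpo ρ U = oddExpo ρ V := by
    unfold oddExpo
    refine Finset.sum_congr rfl fun p _ => ?_
    by_cases hp : halfWeight p = 0
    · rw [hp, zero_mul, zero_mul]
    · rw [plaqObs_eq_of_halfWeight_ne_zero ρ hUV hp]
  show oddF ρ q β U = oddF ρ q β V
  unfold oddF
  rw [hD, hE]

/-! ## The cancellation of the Boltzmann weight -/

open scoped Classical in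
/-- **`E(ΘU) + E(U) - S(U) = -∑_{slab} (N - Re tr ρ(U_q))`.** [folklore] -/
theorem oddExpo_configReflect_add [TopologicalSpace G] [IsTopologicalGroup G] [CompactSpace G]
    (hij : i ≠ j) (hρ : Continuous ρ) (U : Config (TiltedSite d i j (2 * P + 1) (2 * P + 1) L) d G) :
    oddExpo ρ (configReflect (tiltedUnit d i j (2 * P + 1) (2 * P + 1) L) i (tiltedAxisFlip d L (2 * P + 1) hij) U) +
      oddExpo ρ U - wilsonAction ρ (tiltedUnit d i j (2 * P + 1) (2 * P + 1) L) U =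
      -∑ p ∈ Finset.univ.filter (IsSlabPlaq (P := P)),
        ((N : ℝ) - plaqObs ρ (tiltedUnit d i j (2 * P + 1) (2 * P + 1) L) p U) := by
  have hF : IsAxisFlip (tiltedUnit d i j (2 * P + 1) (2 * P + 1) L) i (tiltedAxisFlip d L (2 * P + 1) hij) :=
    isAxisFlip_tiltedAxisFlip d L (2 * P + 1) hij
  -- reindex `E(ΘU)` along the involution `plaqReflect`
  have h1 : oddExpo ρ (configReflect (tiltedUnit d i j (2 * P + 1) (2 * P + 1) L) i (tiltedAxisFlip d L (2 * P + 1) hij) U) =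
      ∑ p : Plaq (TiltedSite d i j (2 * P + 1) (2 * P + 1) L) d,
        halfWeight (IsSiteFrame.plaqReflect (tiltedUnit d i j (2 * P + 1) (2 * P + 1) L) i (tiltedAxisFlip d L (2 * P + 1) hij) p) *
          ((N : ℝ) - plaqObs ρ (tiltedUnit d i j (2 * P + 1) (2 * P + 1) L) p U) := by
    unfold oddExpo
    simp_rw [hF.plaqObs_configReflect ρ hρ]
    exact Fintype.sum_equiv (Function.Involutive.toPerm _ hF.plaqReflect_plaqReflect) _ _
      fun p => by simp [hF.plaqReflect_plaqReflect p]
  rw [h1, oddExpo, wilsonAction, ← Finset.sum_add_distrib, ← Finset.sum_sub_distrib, ← Finset.sum_neg_distrib,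
    Finset.sum_filter]
  refine Finset.sum_congr rfl fun p _ => ?_
  have h2 := halfWeight_add_halfWeight_plaqReflect hij p
  by_cases hs : IsSlabPlaq (P := P) p
  · rw [if_pos hs] at h2; rw [if_pos hs]; linear_combination ((N : ℝ) - plaqObs ρ (tiltedUnit d i j (2 * P + 1) (2 * P + 1) L) p U) * h2
  · rw [if_neg hs] at h2; rw [if_neg hs]; linear_combination ((N : ℝ) - plaqObs ρ (tiltedUnit d i j (2 * P + 1) (2 * P + 1) L) p U) * h2

/-! ## The reflected difference -/

omit [NeZero L] [NeZero P] in
/-- **`(W_{y₀} - W_{y₀+T})(ΘU) = W_{y₀+T+e_i}(U) - W_{y₀+e_i}(U)`** (the twist lemma). [folklore] -/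
theorem oddDiff_configReflect [TopologicalSpace G] [IsTopologicalGroup G] [CompactSpace G]
    (hij : i ≠ j) (hq1 : q.1.1 ≠ i) (hq2 : q.1.2 ≠ i) (hρ : Continuous ρ)
    (U : Config (TiltedSite d i j (2 * P + 1) (2 * P + 1) L) d G) :
    oddDiff ρ q (configReflect (tiltedUnit d i j (2 * P + 1) (2 * P + 1) L) i (tiltedAxisFlip d L (2 * P + 1) hij) U) =
      oddW ρ q (oddLayerSite d i j L P + tiltedTwist d L (2 * P + 1) + tiltedUnit d i j (2 * P + 1) (2 * P + 1) L i) U -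
      oddW ρ q (oddLayerSite d i j L P + tiltedUnit d i j (2 * P + 1) (2 * P + 1) L i) U := by
  have hF : IsAxisFlip (tiltedUnit d i j (2 * P + 1) (2 * P + 1) L) i (tiltedAxisFlip d L (2 * P + 1) hij) :=
    isAxisFlip_tiltedAxisFlip d L (2 * P + 1) hij
  have hnot : ∀ x : TiltedSite d i j (2 * P + 1) (2 * P + 1) L,
      ¬ HasDir ((x, q) : Plaq (TiltedSite d i j (2 * P + 1) (2 * P + 1) L) d) i :=
    fun x h => h.elim hq1 hq2
  have hrefl : ∀ x : TiltedSite d i j (2 * P + 1) (2 * P + 1) L,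
      IsSiteFrame.plaqReflect (tiltedUnit d i j (2 * P + 1) (2 * P + 1) L) i (tiltedAxisFlip d L (2 * P + 1) hij) (x, q) =
        (tiltedAxisFlip d L (2 * P + 1) hij x, q) := fun x =>
    Prod.ext (IsSiteFrame.plaqReflect_fst_of_not_hasDir (hnot x)) (IsSiteFrame.plaqReflect_snd _)
  have h0 : tiltedAxisFlip d L (2 * P + 1) hij (oddLayerSite d i j L P) =
      oddLayerSite d i j L P + tiltedTwist d L (2 * P + 1) + tiltedUnit d i j (2 * P + 1) (2 * P + 1) L i := by
    rw [tiltedAxisFlip_of_axisCoord_eq d L P hij _ axisCoord_oddLayerSite, add_right_comm]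
  have hT : tiltedAxisFlip d L (2 * P + 1) hij (oddLayerSite d i j L P + tiltedTwist d L (2 * P + 1)) =
      oddLayerSite d i j L P + tiltedUnit d i j (2 * P + 1) (2 * P + 1) L i := by
    rw [map_add, tiltedAxisFlip_tiltedTwist, tiltedAxisFlip_of_axisCoord_eq d L P hij _ axisCoord_oddLayerSite,
      add_assoc, add_assoc, tiltedTwist_add_tiltedTwist d L _ hij, add_zero]
  unfold oddDiff oddW
  rw [hF.plaqObs_configReflect ρ hρ, hF.plaqObs_configReflect ρ hρ, hrefl, hrefl, h0, hT]

/-! ## The difference is not negligible -/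

variable [TopologicalSpace G] [IsTopologicalGroup G] [CompactSpace G] [MeasurableSpace G] [BorelSpace G]
  [SecondCountableTopology G]

/-- **`0 < ∫ (W_{y₀} - W_{y₀+T})² dμ₀`** for the product Haar measure: the difference is continuous
and non-zero at the configuration with a single non-trivial link on `(y₀, a)` (this link belongs to
`p` but not to `p + T`: `T ≠ 0`, `T + e_b ≠ 0`, `e_b ≠ 0`), and the product Haar measure charges
open sets. Needs `ρ` non-trivial. [folklore] -/
theorem integral_oddDiff_sq_pos [DecidableEq (TiltedSite d i j (2 * P + 1) (2 * P + 1) L)]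
    (hij : i ≠ j) (hq2 : q.1.2 ≠ i)
    (he2 : tiltedUnit d i j (2 * P + 1) (2 * P + 1) L q.1.2 ≠ 0) (hρ : Continuous ρ) (hρ1 : ∃ g, ρ g ≠ 1) :
    0 < ∫ U, oddDiff ρ q U ^ 2 ∂(productHaar (TiltedSite d i j (2 * P + 1) (2 * P + 1) L) d G) := by
  haveI := isProbabilityMeasure_productHaar (A := TiltedSite d i j (2 * P + 1) (2 * P + 1) L) (d := d) (G := G)
  haveI : IsProbabilityMeasure (haarProbability G) := CompactGroup.isProbabilityMeasure_haarMeasure_top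
  haveI : (haarProbability G).IsOpenPosMeasure := by unfold haarProbability; infer_instance
  haveI : (productHaar (TiltedSite d i j (2 * P + 1) (2 * P + 1) L) d G).IsOpenPosMeasure := by
    unfold productHaar; infer_instance
  obtain ⟨g₀, hg₀⟩ := (DiagRPTwo.exists_re_trace_ne_iff ρ hρ).2 hρ1
  have hab : q.1.1 ≠ q.1.2 := ne_of_lt q.2
  -- the special configuration: `g₀` on the link `(y₀, a)`, `1` elsewhere
  have hW1 : oddW ρ q (oddLayerSite d i j L P) (Function.update 1 (oddLayerSite d i j L P, q.1.1) g₀) = ((ρ g₀).trace).re := by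
    unfold oddW plaqObs holonomy
    have h2 : (oddLayerSite d i j L P + tiltedUnit d i j (2 * P + 1) (2 * P + 1) L q.1.1, q.1.2) ≠ (oddLayerSite d i j L P, q.1.1) := fun h => hab (congrArg Prod.snd h).symm
    have h3 : (oddLayerSite d i j L P + tiltedUnit d i j (2 * P + 1) (2 * P + 1) L q.1.2, q.1.1) ≠ (oddLayerSite d i j L P, q.1.1) := fun h => he2 (by
      have := congrArg Prod.fst h; simpa using this)
    have h4 : (oddLayerSite d i j L P, q.1.2) ≠ (oddLayerSite d i j L P, q.1.1) := fun h => hab (congrArg Prod.snd h).symm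
    simp only [Function.update_self, Function.update_of_ne h2, Function.update_of_ne h3,
      Function.update_of_ne h4, Pi.one_apply, mul_one, inv_one]
  have hW2 : oddW ρ q (oddLayerSite d i j L P + tiltedTwist d L (2 * P + 1)) (Function.update 1 (oddLayerSite d i j L P, q.1.1) g₀) = N := by
    unfold oddW plaqObs holonomy
    have h1 : (oddLayerSite d i j L P + tiltedTwist d L (2 * P + 1), q.1.1) ≠ (oddLayerSite d i j L P, q.1.1) := fun h =>
      tiltedTwist_ne_zero (L := L) (P := P) hij (by have := congrArg Prod.fst h; simpa using this)
    have h2 : (oddLayerSite d i j L P + tiltedTwist d L (2 * P + 1) + tiltedUnit d i j (2 * P + 1) (2 * P + 1) L q.1.1, q.1.2) ≠ (oddLayerSite d i j L P, q.1.1) := fun h => hab (congrArg Prod.snd h).symm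
    have h3 : (oddLayerSite d i j L P + tiltedTwist d L (2 * P + 1) + tiltedUnit d i j (2 * P + 1) (2 * P + 1) L q.1.2, q.1.1) ≠ (oddLayerSite d i j L P, q.1.1) := fun h =>
      tiltedTwist_add_unit_ne_zero (L := L) (P := P) hij hq2 (by
        have := congrArg Prod.fst h; rw [add_assoc] at this; simpa using this)
    have h4 : (oddLayerSite d i j L P + tiltedTwist d L (2 * P + 1), q.1.2) ≠ (oddLayerSite d i j L P, q.1.1) := fun h => hab (congrArg Prod.snd h).symm
    simp only [Function.update_of_ne h1, Function.update_of_ne h2, Function.update_of_ne h3,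
      Function.update_of_ne h4, Pi.one_apply, mul_one, inv_one, map_one, Matrix.trace_one, Fintype.card_fin,
      Complex.natCast_re]
  have hne : oddDiff ρ q (Function.update 1 (oddLayerSite d i j L P, q.1.1) g₀) ≠ 0 := by
    unfold oddDiff; rw [hW1, hW2]; exact sub_ne_zero.2 hg₀
  -- positivity on the open set where the difference is non-zero
  have hcont := continuous_oddDiff (i := i) (j := j) (L := L) (P := P) ρ q hρ
  have hint : Integrable (fun U => oddDiff ρ q U ^ 2) (productHaar (TiltedSite d i j (2 * P + 1) (2 * P + 1) L) d G) :=
    (hcont.pow 2).integrable_of_hasCompactSupport (HasCompactSupport.of_compactSpace _)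
  rw [integral_pos_iff_support_of_nonneg (fun U => sq_nonneg _) hint]
  have hopen : IsOpen {U : Config (TiltedSite d i j (2 * P + 1) (2 * P + 1) L) d G | oddDiff ρ q U ≠ 0} := isOpen_ne_fun hcont continuous_const
  refine lt_of_lt_of_le (hopen.measure_pos _ ⟨_, hne⟩) (measure_mono fun U hU => ?_)
  rw [Function.mem_support]
  exact pow_ne_zero 2 hU

end Witness

end TiltedRP

end Summit.QuantumFields.GaugeBoot

end
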